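import Summits.BirchSwinnertonDyer.Rank1Residual.Additive.X3ThreeLineDatum
import Summits.BirchSwinnertonDyer.Rank1Residual.X2.CellAGVParCertificatesN9A
import Mathlib.Tactic.Simproc.Factors
import HarnessLib

/-!
# X3♯(G-ord, `e = 2`) at `p = 3`: kernel records of the per-pair LINE DATUM `X3LineDatumThree W` for the
# Case-1 members of the B-X3G booking list — part M of 16 (cell `bsd-addord`, seat
# `bsd-addord-twist`, strategy = twist transport)

HONEST FRAMING (cell `bsd-addord`, `run/shared/lean/pub/bsd-addord/README.md` §4): the programme's
target of record is the full Birch–Swinnerton-Dyer formula for every `E/ℚ` of analytic rank `≤ 1`.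
DATA-RECORDS module: theorems only (no definition, no named fact, no `sorry`); it BOOKS NOTHING and
moves no mark — booking is the planner's act (TARGET.md v5.5 §8 protocol B-X3G, (iv)).

## What is recorded

For each isogeny class `(N, class, 3)` of the booking list `HOME/bsd-addord-twist-booking-members.tsv`
(kit job j242057; the r_an = 0, non-CM, non-degenerate branch-parity classes of cell (G-ord, `e = 2`) at
`p = 3` in census v2, planner keys `HOME/planner/bx3g/`), the CASE-1 MEMBER `W = [a₁, a₂, a₃, a₄, a₆]`
(Cremona's globally minimal model; the first member in Cremona order carrying the EVEN rational `3`-line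
as a SUB-line) and the theorem `X3LineDatumThree W` — SOME rational `3`-line `Φ₀ ≤ W[3]` which is even,
has non-trivial `Γ_ℚ`-action and `χ_{−3}`-twist ramified at `3` — proved by
`x3LineDatumThree_of_cert_of_delta` from the certificate `(x₀, s, D, q)`: `Ψ₃(x₀) = 0`, `D` squarefree,
`s ≠ 0`, `D·s² = Ψ₂Sq(x₀)`, `0 < D`, `D ≠ 1`, `3 ∤ D` (`norm_num` identities, one prime-factor-list
computation with X2a's helper `squarefree_of_nodup_primeFactorsList_natAbs`, `decide`s). This is the per-pair line-datum input of
`ClassX3Gord.{{missingLowerBoundAt,bsdp}}_three_rankZero_of_facts_of_nonAnomalous`; the class binders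
(`ClassX3Gord W 3`, `¬ HasCM`, `analyticRank = 0`, `ReductionNonAnomalous W 3`) are data of record
(Cremona / the planner's two-engine census), NOT kernel statements here; the other members of each class
are reached by Cassels (`N10.bsdp_of_isIsogenous_of_bsdp`, binder `bsdRHS_eq_of_isIsogenous`). The
docstring of each record names the class, the anomalous bit of the twist `V = W ⊗ χ_{−3}` and `D`
(`φ = χ_D`). Records sorted by conductor.

References: [GreenbergVatsal2000] §2 p. 28 (the line `Φ`); lane file
`HOME/bsd-addord-twist-booking-members.tsv`; `Additive/X3ThreeLineDatum.lean`.
-/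

set_option autoImplicit false

open WeierstrassCurve Polynomial Literature.NumberTheory.EllipticCurves
  Literature.NumberTheory.EllipticCurves.Rank1Residual

namespace Summit.BirchSwinnertonDyer.Rank1Residual.Additive.X3ThreeLineDatumRecords

/-- `378450bj2` = `[1,-1,0,-8517210417,264330508290741]` (class `378450bj`, (G-ord, `e = 2`) at `3`; twist `42050w2`, `a₃(V) = -2` — ANOMALOUS (outside the end state as typed); even line
`φ = χ_{145}`): `x₀ = 91459`, `D = 145`, `s = 2628125`, `Ψ₂Sq(x₀) = 1001520947265625` ⇒ `X3LineDatumThree W`. [folklore] -/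
theorem x3LineDatumThree_378450bj2 : X3LineDatumThree (⟨1, -1, 0, -8517210417, 264330508290741⟩ : WeierstrassCurve ℚ) :=
  x3LineDatumThree_of_cert_of_delta _ (by norm_num [Δ, b₂, b₄, b₆, b₈]) 91459 2628125 145
    (by simp only [Ψ₃, eval_add, eval_mul, eval_pow, eval_C, eval_X, eval_ofNat]; norm_num [b₂, b₄, b₆, b₈])
    (X2.CellACertN9.squarefree_of_nodup_primeFactorsList_natAbs (by norm_num) (by simp [Nat.primeFactorsList_ofNat])) (by norm_num)
    (by rw [KernelDisc.eval_Ψ₂Sq]; norm_num [b₂, b₄, b₆]) (by decide) (by decide) (by decide)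

/-- `378450ch2` = `[1,-1,0,4348233,-10356416379]` (class `378450ch`, (G-ord, `e = 2`) at `3`; twist `42050t2`, `a₃(V) = 1` — ANOMALOUS (outside the end state as typed); even line
`φ = χ_{145}`): `x₀ = 2719`, `D = 145`, `s = 24389`, `Ψ₂Sq(x₀) = 86249381545` ⇒ `X3LineDatumThree W`. [folklore] -/
theorem x3LineDatumThree_378450ch2 : X3LineDatumThree (⟨1, -1, 0, 4348233, -10356416379⟩ : WeierstrassCurve ℚ) :=
  x3LineDatumThree_of_cert_of_delta _ (by norm_num [Δ, b₂, b₄, b₆, b₈]) 2719 24389 145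
    (by simp only [Ψ₃, eval_add, eval_mul, eval_pow, eval_C, eval_X, eval_ofNat]; norm_num [b₂, b₄, b₆, b₈])
    (X2.CellACertN9.squarefree_of_nodup_primeFactorsList_natAbs (by norm_num) (by simp [Nat.primeFactorsList_ofNat])) (by norm_num)
    (by rw [KernelDisc.eval_Ψ₂Sq]; norm_num [b₂, b₄, b₆]) (by decide) (by decide) (by decide)

/-- `378450cr2` = `[1,-1,1,108705820,-1294443341553]` (class `378450cr`, (G-ord, `e = 2`) at `3`; twist `42050p2`, `a₃(V) = -1`, non-anomalous; even line
`φ = χ_{29}`): `x₀ = 13594`, `D = 29`, `s = 609725`, `Ψ₂Sq(x₀) = 10781172693125` ⇒ `X3LineDatumThree W`. [folklore] -/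
theorem x3LineDatumThree_378450cr2 : X3LineDatumThree (⟨1, -1, 1, 108705820, -1294443341553⟩ : WeierstrassCurve ℚ) :=
  x3LineDatumThree_of_cert_of_delta _ (by norm_num [Δ, b₂, b₄, b₆, b₈]) 13594 609725 29
    (by simp only [Ψ₃, eval_add, eval_mul, eval_pow, eval_C, eval_X, eval_ofNat]; norm_num [b₂, b₄, b₆, b₈])
    (X2.CellACertN9.squarefree_of_nodup_primeFactorsList_natAbs (by norm_num) (by simp [Nat.primeFactorsList_ofNat])) (by norm_num)
    (by rw [KernelDisc.eval_Ψ₂Sq]; norm_num [b₂, b₄, b₆]) (by decide) (by decide) (by decide)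

/-- `378450di2` = `[1,-1,1,-52703105,148672038147]` (class `378450di`, (G-ord, `e = 2`) at `3`; twist `42050m2`, `a₃(V) = -1`, non-anomalous; even line
`φ = χ_{5}`): `x₀ = 3154`, `D = 5`, `s = 105125`, `Ψ₂Sq(x₀) = 55256328125` ⇒ `X3LineDatumThree W`. [folklore] -/
theorem x3LineDatumThree_378450di2 : X3LineDatumThree (⟨1, -1, 1, -52703105, 148672038147⟩ : WeierstrassCurve ℚ) :=
  x3LineDatumThree_of_cert_of_delta _ (by norm_num [Δ, b₂, b₄, b₆, b₈]) 3154 105125 5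
    (by simp only [Ψ₃, eval_add, eval_mul, eval_pow, eval_C, eval_X, eval_ofNat]; norm_num [b₂, b₄, b₆, b₈])
    (X2.CellACertN9.squarefree_of_nodup_primeFactorsList_natAbs (by norm_num) (by simp [Nat.primeFactorsList_ofNat])) (by norm_num)
    (by rw [KernelDisc.eval_Ψ₂Sq]; norm_num [b₂, b₄, b₆]) (by decide) (by decide) (by decide)

/-- `378450ee2` = `[1,-1,1,-10127480,10840548147]` (class `378450ee`, (G-ord, `e = 2`) at `3`; twist `42050n2`, `a₃(V) = 2`, non-anomalous; even line
`φ = χ_{5}`): `x₀ = 3154`, `D = 5`, `s = 90625`, `Ψ₂Sq(x₀) = 41064453125` ⇒ `X3LineDatumThree W`. [folklore] -/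
theorem x3LineDatumThree_378450ee2 : X3LineDatumThree (⟨1, -1, 1, -10127480, 10840548147⟩ : WeierstrassCurve ℚ) :=
  x3LineDatumThree_of_cert_of_delta _ (by norm_num [Δ, b₂, b₄, b₆, b₈]) 3154 90625 5
    (by simp only [Ψ₃, eval_add, eval_mul, eval_pow, eval_C, eval_X, eval_ofNat]; norm_num [b₂, b₄, b₆, b₈])
    (X2.CellACertN9.squarefree_of_nodup_primeFactorsList_natAbs (by norm_num) (by simp [Nat.primeFactorsList_ofNat])) (by norm_num)
    (by rw [KernelDisc.eval_Ψ₂Sq]; norm_num [b₂, b₄, b₆]) (by decide) (by decide) (by decide)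

/-- `378450eg2` = `[1,-1,1,-1801580,947486697]` (class `378450eg`, (G-ord, `e = 2`) at `3`; twist `42050q2`, `a₃(V) = 2`, non-anomalous; even line
`φ = χ_{29}`): `x₀ = 544`, `D = 29`, `s = 4205`, `Ψ₂Sq(x₀) = 512778725` ⇒ `X3LineDatumThree W`. [folklore] -/
theorem x3LineDatumThree_378450eg2 : X3LineDatumThree (⟨1, -1, 1, -1801580, 947486697⟩ : WeierstrassCurve ℚ) :=
  x3LineDatumThree_of_cert_of_delta _ (by norm_num [Δ, b₂, b₄, b₆, b₈]) 544 4205 29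
    (by simp only [Ψ₃, eval_add, eval_mul, eval_pow, eval_C, eval_X, eval_ofNat]; norm_num [b₂, b₄, b₆, b₈])
    (X2.CellACertN9.squarefree_of_nodup_primeFactorsList_natAbs (by norm_num) (by simp [Nat.primeFactorsList_ofNat])) (by norm_num)
    (by rw [KernelDisc.eval_Ψ₂Sq]; norm_num [b₂, b₄, b₆]) (by decide) (by decide) (by decide)

/-- `378450l2` = `[1,-1,0,-45039492,118390797666]` (class `378450l`, (G-ord, `e = 2`) at `3`; twist `42050x2`, `a₃(V) = -2` — ANOMALOUS (outside the end state as typed); even line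
`φ = χ_{145}`): `x₀ = 2719`, `D = 145`, `s = 21025`, `Ψ₂Sq(x₀) = 64097340625` ⇒ `X3LineDatumThree W`. [folklore] -/
theorem x3LineDatumThree_378450l2 : X3LineDatumThree (⟨1, -1, 0, -45039492, 118390797666⟩ : WeierstrassCurve ℚ) :=
  x3LineDatumThree_of_cert_of_delta _ (by norm_num [Δ, b₂, b₄, b₆, b₈]) 2719 21025 145
    (by simp only [Ψ₃, eval_add, eval_mul, eval_pow, eval_C, eval_X, eval_ofNat]; norm_num [b₂, b₄, b₆, b₈])
    (X2.CellACertN9.squarefree_of_nodup_primeFactorsList_natAbs (by norm_num) (by simp [Nat.primeFactorsList_ofNat])) (by norm_num)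
    (by rw [KernelDisc.eval_Ψ₂Sq]; norm_num [b₂, b₄, b₆]) (by decide) (by decide) (by decide)

/-- `378450r2` = `[1,-1,0,-62667,6110991]` (class `378450r`, (G-ord, `e = 2`) at `3`; twist `42050s2`, `a₃(V) = 1` — ANOMALOUS (outside the end state as typed); even line
`φ = χ_{145}`): `x₀ = 109`, `D = 145`, `s = 125`, `Ψ₂Sq(x₀) = 2265625` ⇒ `X3LineDatumThree W`. [folklore] -/
theorem x3LineDatumThree_378450r2 : X3LineDatumThree (⟨1, -1, 0, -62667, 6110991⟩ : WeierstrassCurve ℚ) :=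
  x3LineDatumThree_of_cert_of_delta _ (by norm_num [Δ, b₂, b₄, b₆, b₈]) 109 125 145
    (by simp only [Ψ₃, eval_add, eval_mul, eval_pow, eval_C, eval_X, eval_ofNat]; norm_num [b₂, b₄, b₆, b₈])
    (X2.CellACertN9.squarefree_of_nodup_primeFactorsList_natAbs (by norm_num) (by simp [Nat.primeFactorsList_ofNat])) (by norm_num)
    (by rw [KernelDisc.eval_Ψ₂Sq]; norm_num [b₂, b₄, b₆]) (by decide) (by decide) (by decide)

/-- `379584q2` = `[0,0,0,-37884,-377296]` (class `379584q`, (G-ord, `e = 2`) at `3`; twist `42176f2`, `a₃(V) = 2`, non-anomalous; even line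
`φ = χ_{2}`): `x₀ = 294`, `D = 2`, `s = 5272`, `Ψ₂Sq(x₀) = 55587968` ⇒ `X3LineDatumThree W`. [folklore] -/
theorem x3LineDatumThree_379584q2 : X3LineDatumThree (⟨0, 0, 0, -37884, -377296⟩ : WeierstrassCurve ℚ) :=
  x3LineDatumThree_of_cert_of_delta _ (by norm_num [Δ, b₂, b₄, b₆, b₈]) 294 5272 2
    (by simp only [Ψ₃, eval_add, eval_mul, eval_pow, eval_C, eval_X, eval_ofNat]; norm_num [b₂, b₄, b₆, b₈])
    Int.prime_two.squarefree (by norm_num)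
    (by rw [KernelDisc.eval_Ψ₂Sq]; norm_num [b₂, b₄, b₆]) (by decide) (by decide) (by decide)

/-- `379746m2` = `[1,-1,0,-31586598,68258958412]` (class `379746m`, (G-ord, `e = 2`) at `3`; twist `42194p2`, `a₃(V) = 2`, non-anomalous; even line
`φ = χ_{17}`): `x₀ = 3685`, `D = 17`, `s = 21097`, `Ψ₂Sq(x₀) = 7566417953` ⇒ `X3LineDatumThree W`. [folklore] -/
theorem x3LineDatumThree_379746m2 : X3LineDatumThree (⟨1, -1, 0, -31586598, 68258958412⟩ : WeierstrassCurve ℚ) :=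
  x3LineDatumThree_of_cert_of_delta _ (by norm_num [Δ, b₂, b₄, b₆, b₈]) 3685 21097 17
    (by simp only [Ψ₃, eval_add, eval_mul, eval_pow, eval_C, eval_X, eval_ofNat]; norm_num [b₂, b₄, b₆, b₈])
    (X2.CellACertN9.squarefree_of_nodup_primeFactorsList_natAbs (by norm_num) (by simp [Nat.primeFactorsList_ofNat])) (by norm_num)
    (by rw [KernelDisc.eval_Ψ₂Sq]; norm_num [b₂, b₄, b₆]) (by decide) (by decide) (by decide)

/-- `380880cn3` = `[0,0,0,-196788,33593087]` (class `380880cn`, (G-ord, `e = 2`) at `3`; twist `42320z3`, `a₃(V) = 2`, non-anomalous; even line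
`φ = χ_{23}`): `x₀ = 276`, `D = 23`, `s = 230`, `Ψ₂Sq(x₀) = 1216700` ⇒ `X3LineDatumThree W`. [folklore] -/
theorem x3LineDatumThree_380880cn3 : X3LineDatumThree (⟨0, 0, 0, -196788, 33593087⟩ : WeierstrassCurve ℚ) :=
  x3LineDatumThree_of_cert_of_delta _ (by norm_num [Δ, b₂, b₄, b₆, b₈]) 276 230 23
    (by simp only [Ψ₃, eval_add, eval_mul, eval_pow, eval_C, eval_X, eval_ofNat]; norm_num [b₂, b₄, b₆, b₈])
    (X2.CellACertN9.squarefree_of_nodup_primeFactorsList_natAbs (by norm_num) (by simp [Nat.primeFactorsList_ofNat])) (by norm_num)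
    (by rw [KernelDisc.eval_Ψ₂Sq]; norm_num [b₂, b₄, b₆]) (by decide) (by decide) (by decide)

/-- `380880f2` = `[0,0,0,13317,-327382]` (class `380880f`, (G-ord, `e = 2`) at `3`; twist `42320x2`, `a₃(V) = -1`, non-anomalous; even line
`φ = χ_{23}`): `x₀ = 69`, `D = 23`, `s = 400`, `Ψ₂Sq(x₀) = 3680000` ⇒ `X3LineDatumThree W`. [folklore] -/
theorem x3LineDatumThree_380880f2 : X3LineDatumThree (⟨0, 0, 0, 13317, -327382⟩ : WeierstrassCurve ℚ) :=
  x3LineDatumThree_of_cert_of_delta _ (by norm_num [Δ, b₂, b₄, b₆, b₈]) 69 400 23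
    (by simp only [Ψ₃, eval_add, eval_mul, eval_pow, eval_C, eval_X, eval_ofNat]; norm_num [b₂, b₄, b₆, b₈])
    (X2.CellACertN9.squarefree_of_nodup_primeFactorsList_natAbs (by norm_num) (by simp [Nat.primeFactorsList_ofNat])) (by norm_num)
    (by rw [KernelDisc.eval_Ψ₂Sq]; norm_num [b₂, b₄, b₆]) (by decide) (by decide) (by decide)

/-- `380880j2` = `[0,0,0,1969467,4616512643]` (class `380880j`, (G-ord, `e = 2`) at `3`; twist `42320y2`, `a₃(V) = -1`, non-anomalous; even line
`φ = χ_{23}`): `x₀ = 69`, `D = 23`, `s = 28750`, `Ψ₂Sq(x₀) = 19010937500` ⇒ `X3LineDatumThree W`. [folklore] -/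
theorem x3LineDatumThree_380880j2 : X3LineDatumThree (⟨0, 0, 0, 1969467, 4616512643⟩ : WeierstrassCurve ℚ) :=
  x3LineDatumThree_of_cert_of_delta _ (by norm_num [Δ, b₂, b₄, b₆, b₈]) 69 28750 23
    (by simp only [Ψ₃, eval_add, eval_mul, eval_pow, eval_C, eval_X, eval_ofNat]; norm_num [b₂, b₄, b₆, b₈])
    (X2.CellACertN9.squarefree_of_nodup_primeFactorsList_natAbs (by norm_num) (by simp [Nat.primeFactorsList_ofNat])) (by norm_num)
    (by rw [KernelDisc.eval_Ψ₂Sq]; norm_num [b₂, b₄, b₆]) (by decide) (by decide) (by decide)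

/-- `381150ja2` = `[1,-1,1,176395,-57704853]` (class `381150ja`, (G-ord, `e = 2`) at `3`; twist `42350j2`, `a₃(V) = -1`, non-anomalous; even line
`φ = χ_{5}`): `x₀ = 454`, `D = 5`, `s = 9625`, `Ψ₂Sq(x₀) = 463203125` ⇒ `X3LineDatumThree W`. [folklore] -/
theorem x3LineDatumThree_381150ja2 : X3LineDatumThree (⟨1, -1, 1, 176395, -57704853⟩ : WeierstrassCurve ℚ) :=
  x3LineDatumThree_of_cert_of_delta _ (by norm_num [Δ, b₂, b₄, b₆, b₈]) 454 9625 5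
    (by simp only [Ψ₃, eval_add, eval_mul, eval_pow, eval_C, eval_X, eval_ofNat]; norm_num [b₂, b₄, b₆, b₈])
    (X2.CellACertN9.squarefree_of_nodup_primeFactorsList_natAbs (by norm_num) (by simp [Nat.primeFactorsList_ofNat])) (by norm_num)
    (by rw [KernelDisc.eval_Ψ₂Sq]; norm_num [b₂, b₄, b₆]) (by decide) (by decide) (by decide)

/-- `381150jx2` = `[1,-1,1,-385928555,2918252335947]` (class `381150jx`, (G-ord, `e = 2`) at `3`; twist `42350h2`, `a₃(V) = -1`, non-anomalous; even line
`φ = χ_{5}`): `x₀ = 11344`, `D = 5`, `s = 275`, `Ψ₂Sq(x₀) = 378125` ⇒ `X3LineDatumThree W`. [folklore] -/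
theorem x3LineDatumThree_381150jx2 : X3LineDatumThree (⟨1, -1, 1, -385928555, 2918252335947⟩ : WeierstrassCurve ℚ) :=
  x3LineDatumThree_of_cert_of_delta _ (by norm_num [Δ, b₂, b₄, b₆, b₈]) 11344 275 5
    (by simp only [Ψ₃, eval_add, eval_mul, eval_pow, eval_C, eval_X, eval_ofNat]; norm_num [b₂, b₄, b₆, b₈])
    (X2.CellACertN9.squarefree_of_nodup_primeFactorsList_natAbs (by norm_num) (by simp [Nat.primeFactorsList_ofNat])) (by norm_num)
    (by rw [KernelDisc.eval_Ψ₂Sq]; norm_num [b₂, b₄, b₆]) (by decide) (by decide) (by decide)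

/-- `381150kd2` = `[1,-1,1,43055770,330656621397]` (class `381150kd`, (G-ord, `e = 2`) at `3`; twist `42350n2`, `a₃(V) = 2`, non-anomalous; even line
`φ = χ_{5}`): `x₀ = 454`, `D = 5`, `s = 529375`, `Ψ₂Sq(x₀) = 1401189453125` ⇒ `X3LineDatumThree W`. [folklore] -/
theorem x3LineDatumThree_381150kd2 : X3LineDatumThree (⟨1, -1, 1, 43055770, 330656621397⟩ : WeierstrassCurve ℚ) :=
  x3LineDatumThree_of_cert_of_delta _ (by norm_num [Δ, b₂, b₄, b₆, b₈]) 454 529375 5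
    (by simp only [Ψ₃, eval_add, eval_mul, eval_pow, eval_C, eval_X, eval_ofNat]; norm_num [b₂, b₄, b₆, b₈])
    (X2.CellACertN9.squarefree_of_nodup_primeFactorsList_natAbs (by norm_num) (by simp [Nat.primeFactorsList_ofNat])) (by norm_num)
    (by rw [KernelDisc.eval_Ψ₂Sq]; norm_num [b₂, b₄, b₆]) (by decide) (by decide) (by decide)

/-- `381150mw2` = `[1,-1,1,-17657414105,903110496291897]` (class `381150mw`, (G-ord, `e = 2`) at `3`; twist `42350l2`, `a₃(V) = -1`, non-anomalous; even line
`φ = χ_{5}`): `x₀ = 76684`, `D = 5`, `s = 15125`, `Ψ₂Sq(x₀) = 1143828125` ⇒ `X3LineDatumThree W`. [folklore] -/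
theorem x3LineDatumThree_381150mw2 : X3LineDatumThree (⟨1, -1, 1, -17657414105, 903110496291897⟩ : WeierstrassCurve ℚ) :=
  x3LineDatumThree_of_cert_of_delta _ (by norm_num [Δ, b₂, b₄, b₆, b₈]) 76684 15125 5
    (by simp only [Ψ₃, eval_add, eval_mul, eval_pow, eval_C, eval_X, eval_ofNat]; norm_num [b₂, b₄, b₆, b₈])
    (X2.CellACertN9.squarefree_of_nodup_primeFactorsList_natAbs (by norm_num) (by simp [Nat.primeFactorsList_ofNat])) (by norm_num)
    (by rw [KernelDisc.eval_Ψ₂Sq]; norm_num [b₂, b₄, b₆]) (by decide) (by decide) (by decide)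

/-- `382950gk2` = `[1,-1,1,-1315355,904278147]` (class `382950gk`, (G-ord, `e = 2`) at `3`; twist `42550b2`, `a₃(V) = -1`, non-anomalous; even line
`φ = χ_{5}`): `x₀ = 184`, `D = 5`, `s = 23125`, `Ψ₂Sq(x₀) = 2673828125` ⇒ `X3LineDatumThree W`. [folklore] -/
theorem x3LineDatumThree_382950gk2 : X3LineDatumThree (⟨1, -1, 1, -1315355, 904278147⟩ : WeierstrassCurve ℚ) :=
  x3LineDatumThree_of_cert_of_delta _ (by norm_num [Δ, b₂, b₄, b₆, b₈]) 184 23125 5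
    (by simp only [Ψ₃, eval_add, eval_mul, eval_pow, eval_C, eval_X, eval_ofNat]; norm_num [b₂, b₄, b₆, b₈])
    (X2.CellACertN9.squarefree_of_nodup_primeFactorsList_natAbs (by norm_num) (by simp [Nat.primeFactorsList_ofNat])) (by norm_num)
    (by rw [KernelDisc.eval_Ψ₂Sq]; norm_num [b₂, b₄, b₆]) (by decide) (by decide) (by decide)

/-- `383040lk2` = `[0,0,0,-6492,604784]` (class `383040lk`, (G-ord, `e = 2`) at `3`; twist `42560o2`, `a₃(V) = -1`, non-anomalous; even line
`φ = χ_{2}`): `x₀ = 6`, `D = 2`, `s = 1064`, `Ψ₂Sq(x₀) = 2264192` ⇒ `X3LineDatumThree W`. [folklore] -/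
theorem x3LineDatumThree_383040lk2 : X3LineDatumThree (⟨0, 0, 0, -6492, 604784⟩ : WeierstrassCurve ℚ) :=
  x3LineDatumThree_of_cert_of_delta _ (by norm_num [Δ, b₂, b₄, b₆, b₈]) 6 1064 2
    (by simp only [Ψ₃, eval_add, eval_mul, eval_pow, eval_C, eval_X, eval_ofNat]; norm_num [b₂, b₄, b₆, b₈])
    Int.prime_two.squarefree (by norm_num)
    (by rw [KernelDisc.eval_Ψ₂Sq]; norm_num [b₂, b₄, b₆]) (by decide) (by decide) (by decide)

/-- `383040mm2` = `[0,0,0,5048628,-725574544]` (class `383040mm`, (G-ord, `e = 2`) at `3`; twist `42560q2`, `a₃(V) = 2`, non-anomalous; even line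
`φ = χ_{2}`): `x₀ = 1014`, `D = 2`, `s = 104272`, `Ψ₂Sq(x₀) = 21745299968` ⇒ `X3LineDatumThree W`. [folklore] -/
theorem x3LineDatumThree_383040mm2 : X3LineDatumThree (⟨0, 0, 0, 5048628, -725574544⟩ : WeierstrassCurve ℚ) :=
  x3LineDatumThree_of_cert_of_delta _ (by norm_num [Δ, b₂, b₄, b₆, b₈]) 1014 104272 2
    (by simp only [Ψ₃, eval_add, eval_mul, eval_pow, eval_C, eval_X, eval_ofNat]; norm_num [b₂, b₄, b₆, b₈])
    Int.prime_two.squarefree (by norm_num)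
    (by rw [KernelDisc.eval_Ψ₂Sq]; norm_num [b₂, b₄, b₆]) (by decide) (by decide) (by decide)

/-- `383040ne3` = `[0,0,0,61728,123464]` (class `383040ne`, (G-ord, `e = 2`) at `3`; twist `42560p3`, `a₃(V) = 2`, non-anomalous; even line
`φ = χ_{2}`): `x₀ = 96`, `D = 2`, `s = 3724`, `Ψ₂Sq(x₀) = 27736352` ⇒ `X3LineDatumThree W`. [folklore] -/
theorem x3LineDatumThree_383040ne3 : X3LineDatumThree (⟨0, 0, 0, 61728, 123464⟩ : WeierstrassCurve ℚ) :=
  x3LineDatumThree_of_cert_of_delta _ (by norm_num [Δ, b₂, b₄, b₆, b₈]) 96 3724 2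
    (by simp only [Ψ₃, eval_add, eval_mul, eval_pow, eval_C, eval_X, eval_ofNat]; norm_num [b₂, b₄, b₆, b₈])
    Int.prime_two.squarefree (by norm_num)
    (by rw [KernelDisc.eval_Ψ₂Sq]; norm_num [b₂, b₄, b₆]) (by decide) (by decide) (by decide)

/-- `384192i2` = `[0,0,0,-27616044,56709260336]` (class `384192i`, (G-ord, `e = 2`) at `3`; twist `42688k2`, `a₃(V) = -1`, non-anomalous; even line
`φ = χ_{2}`): `x₀ = 2166`, `D = 2`, `s = 118784`, `Ψ₂Sq(x₀) = 28219277312` ⇒ `X3LineDatumThree W`. [folklore] -/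
theorem x3LineDatumThree_384192i2 : X3LineDatumThree (⟨0, 0, 0, -27616044, 56709260336⟩ : WeierstrassCurve ℚ) :=
  x3LineDatumThree_of_cert_of_delta _ (by norm_num [Δ, b₂, b₄, b₆, b₈]) 2166 118784 2
    (by simp only [Ψ₃, eval_add, eval_mul, eval_pow, eval_C, eval_X, eval_ofNat]; norm_num [b₂, b₄, b₆, b₈])
    Int.prime_two.squarefree (by norm_num)
    (by rw [KernelDisc.eval_Ψ₂Sq]; norm_num [b₂, b₄, b₆]) (by decide) (by decide) (by decide)

/-- `384300z2` = `[0,0,0,-345000,-578387500]` (class `384300z`, (G-ord, `e = 2`) at `3`; twist `42700f2`, `a₃(V) = 2`, non-anomalous; even line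
`φ = χ_{5}`): `x₀ = 1500`, `D = 5`, `s = 42700`, `Ψ₂Sq(x₀) = 9116450000` ⇒ `X3LineDatumThree W`. [folklore] -/
theorem x3LineDatumThree_384300z2 : X3LineDatumThree (⟨0, 0, 0, -345000, -578387500⟩ : WeierstrassCurve ℚ) :=
  x3LineDatumThree_of_cert_of_delta _ (by norm_num [Δ, b₂, b₄, b₆, b₈]) 1500 42700 5
    (by simp only [Ψ₃, eval_add, eval_mul, eval_pow, eval_C, eval_X, eval_ofNat]; norm_num [b₂, b₄, b₆, b₈])
    (X2.CellACertN9.squarefree_of_nodup_primeFactorsList_natAbs (by norm_num) (by simp [Nat.primeFactorsList_ofNat])) (by norm_num)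
    (by rw [KernelDisc.eval_Ψ₂Sq]; norm_num [b₂, b₄, b₆]) (by decide) (by decide) (by decide)

/-- `386325j2` = `[0,0,1,-1611750,787579906]` (class `386325j`, (G-ord, `e = 2`) at `3`; twist `42925g2`, `a₃(V) = -1`, non-anomalous; even line
`φ = χ_{5}`): `x₀ = 735`, `D = 5`, `s = 85`, `Ψ₂Sq(x₀) = 36125` ⇒ `X3LineDatumThree W`. [folklore] -/
theorem x3LineDatumThree_386325j2 : X3LineDatumThree (⟨0, 0, 1, -1611750, 787579906⟩ : WeierstrassCurve ℚ) :=
  x3LineDatumThree_of_cert_of_delta _ (by norm_num [Δ, b₂, b₄, b₆, b₈]) 735 85 5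
    (by simp only [Ψ₃, eval_add, eval_mul, eval_pow, eval_C, eval_X, eval_ofNat]; norm_num [b₂, b₄, b₆, b₈])
    (X2.CellACertN9.squarefree_of_nodup_primeFactorsList_natAbs (by norm_num) (by simp [Nat.primeFactorsList_ofNat])) (by norm_num)
    (by rw [KernelDisc.eval_Ψ₂Sq]; norm_num [b₂, b₄, b₆]) (by decide) (by decide) (by decide)

/-- `386550r2` = `[1,-1,1,-6485,948237]` (class `386550r`, (G-ord, `e = 2`) at `3`; twist `42950a2`, `a₃(V) = -1`, non-anomalous; even line
`φ = χ_{5}`): `x₀ = 4`, `D = 5`, `s = 859`, `Ψ₂Sq(x₀) = 3689405` ⇒ `X3LineDatumThree W`. [folklore] -/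
theorem x3LineDatumThree_386550r2 : X3LineDatumThree (⟨1, -1, 1, -6485, 948237⟩ : WeierstrassCurve ℚ) :=
  x3LineDatumThree_of_cert_of_delta _ (by norm_num [Δ, b₂, b₄, b₆, b₈]) 4 859 5
    (by simp only [Ψ₃, eval_add, eval_mul, eval_pow, eval_C, eval_X, eval_ofNat]; norm_num [b₂, b₄, b₆, b₈])
    (X2.CellACertN9.squarefree_of_nodup_primeFactorsList_natAbs (by norm_num) (by simp [Nat.primeFactorsList_ofNat])) (by norm_num)
    (by rw [KernelDisc.eval_Ψ₂Sq]; norm_num [b₂, b₄, b₆]) (by decide) (by decide) (by decide)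

/-- `388080bd2` = `[0,0,0,63357,15261442]` (class `388080bd`, (G-ord, `e = 2`) at `3`; twist `43120cp2`, `a₃(V) = 1` — ANOMALOUS (outside the end state as typed); even line
`φ = χ_{7}`): `x₀ = 21`, `D = 7`, `s = 3080`, `Ψ₂Sq(x₀) = 66404800` ⇒ `X3LineDatumThree W`. [folklore] -/
theorem x3LineDatumThree_388080bd2 : X3LineDatumThree (⟨0, 0, 0, 63357, 15261442⟩ : WeierstrassCurve ℚ) :=
  x3LineDatumThree_of_cert_of_delta _ (by norm_num [Δ, b₂, b₄, b₆, b₈]) 21 3080 7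
    (by simp only [Ψ₃, eval_add, eval_mul, eval_pow, eval_C, eval_X, eval_ofNat]; norm_num [b₂, b₄, b₆, b₈])
    (X2.CellACertN9.squarefree_of_nodup_primeFactorsList_natAbs (by norm_num) (by simp [Nat.primeFactorsList_ofNat])) (by norm_num)
    (by rw [KernelDisc.eval_Ψ₂Sq]; norm_num [b₂, b₄, b₆]) (by decide) (by decide) (by decide)

/-- `388080dj3` = `[0,0,0,3556077,50143943122]` (class `388080dj`, (G-ord, `e = 2`) at `3`; twist `43120cv3`, `a₃(V) = -2` — ANOMALOUS (outside the end state as typed); even line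
`φ = χ_{7}`): `x₀ = 21`, `D = 7`, `s = 169400`, `Ψ₂Sq(x₀) = 200874520000` ⇒ `X3LineDatumThree W`. [folklore] -/
theorem x3LineDatumThree_388080dj3 : X3LineDatumThree (⟨0, 0, 0, 3556077, 50143943122⟩ : WeierstrassCurve ℚ) :=
  x3LineDatumThree_of_cert_of_delta _ (by norm_num [Δ, b₂, b₄, b₆, b₈]) 21 169400 7
    (by simp only [Ψ₃, eval_add, eval_mul, eval_pow, eval_C, eval_X, eval_ofNat]; norm_num [b₂, b₄, b₆, b₈])
    (X2.CellACertN9.squarefree_of_nodup_primeFactorsList_natAbs (by norm_num) (by simp [Nat.primeFactorsList_ofNat])) (by norm_num)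
    (by rw [KernelDisc.eval_Ψ₂Sq]; norm_num [b₂, b₄, b₆]) (by decide) (by decide) (by decide)

/-- `388080mx2` = `[0,0,0,940935093,71216203585786]` (class `388080mx`, (G-ord, `e = 2`) at `3`; twist `43120bf2`, `a₃(V) = 1` — ANOMALOUS (outside the end state as typed); even line
`φ = χ_{7}`): `x₀ = 1029`, `D = 7`, `s = 6422528`, `Ψ₂Sq(x₀) = 288742061375488` ⇒ `X3LineDatumThree W`. [folklore] -/
theorem x3LineDatumThree_388080mx2 : X3LineDatumThree (⟨0, 0, 0, 940935093, 71216203585786⟩ : WeierstrassCurve ℚ) :=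
  x3LineDatumThree_of_cert_of_delta _ (by norm_num [Δ, b₂, b₄, b₆, b₈]) 1029 6422528 7
    (by simp only [Ψ₃, eval_add, eval_mul, eval_pow, eval_C, eval_X, eval_ofNat]; norm_num [b₂, b₄, b₆, b₈])
    (X2.CellACertN9.squarefree_of_nodup_primeFactorsList_natAbs (by norm_num) (by simp [Nat.primeFactorsList_ofNat])) (by norm_num)
    (by rw [KernelDisc.eval_Ψ₂Sq]; norm_num [b₂, b₄, b₆]) (by decide) (by decide) (by decide)

/-- `388080oh3` = `[0,0,0,-86473632,309509271799]` (class `388080oh`, (G-ord, `e = 2`) at `3`; twist `43120bk3`, `a₃(V) = -2` — ANOMALOUS (outside the end state as typed); even line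
`φ = χ_{7}`): `x₀ = 5376`, `D = 7`, `s = 686`, `Ψ₂Sq(x₀) = 3294172` ⇒ `X3LineDatumThree W`. [folklore] -/
theorem x3LineDatumThree_388080oh3 : X3LineDatumThree (⟨0, 0, 0, -86473632, 309509271799⟩ : WeierstrassCurve ℚ) :=
  x3LineDatumThree_of_cert_of_delta _ (by norm_num [Δ, b₂, b₄, b₆, b₈]) 5376 686 7
    (by simp only [Ψ₃, eval_add, eval_mul, eval_pow, eval_C, eval_X, eval_ofNat]; norm_num [b₂, b₄, b₆, b₈])
    (X2.CellACertN9.squarefree_of_nodup_primeFactorsList_natAbs (by norm_num) (by simp [Nat.primeFactorsList_ofNat])) (by norm_num)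
    (by rw [KernelDisc.eval_Ψ₂Sq]; norm_num [b₂, b₄, b₆]) (by decide) (by decide) (by decide)

/-- `388080q2` = `[0,0,0,987,-8813]` (class `388080q`, (G-ord, `e = 2`) at `3`; twist `43120cw2`, `a₃(V) = -2` — ANOMALOUS (outside the end state as typed); even line
`φ = χ_{7}`): `x₀ = 21`, `D = 7`, `s = 110`, `Ψ₂Sq(x₀) = 84700` ⇒ `X3LineDatumThree W`. [folklore] -/
theorem x3LineDatumThree_388080q2 : X3LineDatumThree (⟨0, 0, 0, 987, -8813⟩ : WeierstrassCurve ℚ) :=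
  x3LineDatumThree_of_cert_of_delta _ (by norm_num [Δ, b₂, b₄, b₆, b₈]) 21 110 7
    (by simp only [Ψ₃, eval_add, eval_mul, eval_pow, eval_C, eval_X, eval_ofNat]; norm_num [b₂, b₄, b₆, b₈])
    (X2.CellACertN9.squarefree_of_nodup_primeFactorsList_natAbs (by norm_num) (by simp [Nat.primeFactorsList_ofNat])) (by norm_num)
    (by rw [KernelDisc.eval_Ψ₂Sq]; norm_num [b₂, b₄, b₆]) (by decide) (by decide) (by decide)

/-- `388080z3` = `[0,0,0,16027557,-33584362742]` (class `388080z`, (G-ord, `e = 2`) at `3`; twist `43120cu3`, `a₃(V) = -2` — ANOMALOUS (outside the end state as typed); even line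
`φ = χ_{7}`): `x₀ = 3549`, `D = 7`, `s = 197120`, `Ψ₂Sq(x₀) = 271994060800` ⇒ `X3LineDatumThree W`. [folklore] -/
theorem x3LineDatumThree_388080z3 : X3LineDatumThree (⟨0, 0, 0, 16027557, -33584362742⟩ : WeierstrassCurve ℚ) :=
  x3LineDatumThree_of_cert_of_delta _ (by norm_num [Δ, b₂, b₄, b₆, b₈]) 3549 197120 7
    (by simp only [Ψ₃, eval_add, eval_mul, eval_pow, eval_C, eval_X, eval_ofNat]; norm_num [b₂, b₄, b₆, b₈])
    (X2.CellACertN9.squarefree_of_nodup_primeFactorsList_natAbs (by norm_num) (by simp [Nat.primeFactorsList_ofNat])) (by norm_num)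
    (by rw [KernelDisc.eval_Ψ₂Sq]; norm_num [b₂, b₄, b₆]) (by decide) (by decide) (by decide)

/-- `391050fa2` = `[1,-1,1,-24160799480,-1537801062638853]` (class `391050fa`, (G-ord, `e = 2`) at `3`; twist `43450g2`, `a₃(V) = -1`, non-anomalous; even line
`φ = χ_{5}`): `x₀ = 271354`, `D = 5`, `s = 97515625`, `Ψ₂Sq(x₀) = 47546485595703125` ⇒ `X3LineDatumThree W`. [folklore] -/
theorem x3LineDatumThree_391050fa2 : X3LineDatumThree (⟨1, -1, 1, -24160799480, -1537801062638853⟩ : WeierstrassCurve ℚ) :=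
  x3LineDatumThree_of_cert_of_delta _ (by norm_num [Δ, b₂, b₄, b₆, b₈]) 271354 97515625 5
    (by simp only [Ψ₃, eval_add, eval_mul, eval_pow, eval_C, eval_X, eval_ofNat]; norm_num [b₂, b₄, b₆, b₈])
    (X2.CellACertN9.squarefree_of_nodup_primeFactorsList_natAbs (by norm_num) (by simp [Nat.primeFactorsList_ofNat])) (by norm_num)
    (by rw [KernelDisc.eval_Ψ₂Sq]; norm_num [b₂, b₄, b₆]) (by decide) (by decide) (by decide)

/-- `391104cr2` = `[0,0,0,-147180,-39751504]` (class `391104cr`, (G-ord, `e = 2`) at `3`; twist `43456h2`, `a₃(V) = -1`, non-anomalous; even line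
`φ = χ_{2}`): `x₀ = 726`, `D = 2`, `s = 21728`, `Ψ₂Sq(x₀) = 944211968` ⇒ `X3LineDatumThree W`. [folklore] -/
theorem x3LineDatumThree_391104cr2 : X3LineDatumThree (⟨0, 0, 0, -147180, -39751504⟩ : WeierstrassCurve ℚ) :=
  x3LineDatumThree_of_cert_of_delta _ (by norm_num [Δ, b₂, b₄, b₆, b₈]) 726 21728 2
    (by simp only [Ψ₃, eval_add, eval_mul, eval_pow, eval_C, eval_X, eval_ofNat]; norm_num [b₂, b₄, b₆, b₈])
    Int.prime_two.squarefree (by norm_num)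
    (by rw [KernelDisc.eval_Ψ₂Sq]; norm_num [b₂, b₄, b₆]) (by decide) (by decide) (by decide)

/-- `391950a2` = `[1,-1,0,-9837,-600899]` (class `391950a`, (G-ord, `e = 2`) at `3`; twist `43550o2`, `a₃(V) = -1`, non-anomalous; even line
`φ = χ_{5}`): `x₀ = 184`, `D = 5`, `s = 1742`, `Ψ₂Sq(x₀) = 15172820` ⇒ `X3LineDatumThree W`. [folklore] -/
theorem x3LineDatumThree_391950a2 : X3LineDatumThree (⟨1, -1, 0, -9837, -600899⟩ : WeierstrassCurve ℚ) :=
  x3LineDatumThree_of_cert_of_delta _ (by norm_num [Δ, b₂, b₄, b₆, b₈]) 184 1742 5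
    (by simp only [Ψ₃, eval_add, eval_mul, eval_pow, eval_C, eval_X, eval_ofNat]; norm_num [b₂, b₄, b₆, b₈])
    (X2.CellACertN9.squarefree_of_nodup_primeFactorsList_natAbs (by norm_num) (by simp [Nat.primeFactorsList_ofNat])) (by norm_num)
    (by rw [KernelDisc.eval_Ψ₂Sq]; norm_num [b₂, b₄, b₆]) (by decide) (by decide) (by decide)

/-- `391950be2` = `[1,-1,0,-3015567,1981463341]` (class `391950be`, (G-ord, `e = 2`) at `3`; twist `43550p2`, `a₃(V) = 2`, non-anomalous; even line
`φ = χ_{5}`): `x₀ = 1354`, `D = 5`, `s = 17420`, `Ψ₂Sq(x₀) = 1517282000` ⇒ `X3LineDatumThree W`. [folklore] -/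
theorem x3LineDatumThree_391950be2 : X3LineDatumThree (⟨1, -1, 0, -3015567, 1981463341⟩ : WeierstrassCurve ℚ) :=
  x3LineDatumThree_of_cert_of_delta _ (by norm_num [Δ, b₂, b₄, b₆, b₈]) 1354 17420 5
    (by simp only [Ψ₃, eval_add, eval_mul, eval_pow, eval_C, eval_X, eval_ofNat]; norm_num [b₂, b₄, b₆, b₈])
    (X2.CellACertN9.squarefree_of_nodup_primeFactorsList_natAbs (by norm_num) (by simp [Nat.primeFactorsList_ofNat])) (by norm_num)
    (by rw [KernelDisc.eval_Ψ₂Sq]; norm_num [b₂, b₄, b₆]) (by decide) (by decide) (by decide)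

/-- `393129bx2` = `[0,0,1,75742854,91697262808]` (class `393129bx`, (G-ord, `e = 2`) at `3`; twist `43681i2`, `a₃(V) = -1`, non-anomalous; even line
`φ = χ_{209}`): `x₀ = 2508`, `D = 209`, `s = 75449`, `Ψ₂Sq(x₀) = 1189743284609` ⇒ `X3LineDatumThree W`. [folklore] -/
theorem x3LineDatumThree_393129bx2 : X3LineDatumThree (⟨0, 0, 1, 75742854, 91697262808⟩ : WeierstrassCurve ℚ) :=
  x3LineDatumThree_of_cert_of_delta _ (by norm_num [Δ, b₂, b₄, b₆, b₈]) 2508 75449 209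
    (by simp only [Ψ₃, eval_add, eval_mul, eval_pow, eval_C, eval_X, eval_ofNat]; norm_num [b₂, b₄, b₆, b₈])
    (X2.CellACertN9.squarefree_of_nodup_primeFactorsList_natAbs (by norm_num) (by simp [Nat.primeFactorsList_ofNat])) (by norm_num)
    (by rw [KernelDisc.eval_Ψ₂Sq]; norm_num [b₂, b₄, b₆]) (by decide) (by decide) (by decide)

/-- `393129v2` = `[0,0,1,-3669204,2878020967]` (class `393129v`, (G-ord, `e = 2`) at `3`; twist `43681j2`, `a₃(V) = 2`, non-anomalous; even line
`φ = χ_{209}`): `x₀ = 627`, `D = 209`, `s = 3971`, `Ψ₂Sq(x₀) = 3295687769` ⇒ `X3LineDatumThree W`. [folklore] -/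
theorem x3LineDatumThree_393129v2 : X3LineDatumThree (⟨0, 0, 1, -3669204, 2878020967⟩ : WeierstrassCurve ℚ) :=
  x3LineDatumThree_of_cert_of_delta _ (by norm_num [Δ, b₂, b₄, b₆, b₈]) 627 3971 209
    (by simp only [Ψ₃, eval_add, eval_mul, eval_pow, eval_C, eval_X, eval_ofNat]; norm_num [b₂, b₄, b₆, b₈])
    (X2.CellACertN9.squarefree_of_nodup_primeFactorsList_natAbs (by norm_num) (by simp [Nat.primeFactorsList_ofNat])) (by norm_num)
    (by rw [KernelDisc.eval_Ψ₂Sq]; norm_num [b₂, b₄, b₆]) (by decide) (by decide) (by decide)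

/-- `393354d2` = `[1,-1,0,-3636,85378]` (class `393354d`, (G-ord, `e = 2`) at `3`; twist `43706q2`, `a₃(V) = -1`, non-anomalous; even line
`φ = χ_{41}`): `x₀ = 31`, `D = 41`, `s = 13`, `Ψ₂Sq(x₀) = 6929` ⇒ `X3LineDatumThree W`. [folklore] -/
theorem x3LineDatumThree_393354d2 : X3LineDatumThree (⟨1, -1, 0, -3636, 85378⟩ : WeierstrassCurve ℚ) :=
  x3LineDatumThree_of_cert_of_delta _ (by norm_num [Δ, b₂, b₄, b₆, b₈]) 31 13 41
    (by simp only [Ψ₃, eval_add, eval_mul, eval_pow, eval_C, eval_X, eval_ofNat]; norm_num [b₂, b₄, b₆, b₈])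
    (X2.CellACertN9.squarefree_of_nodup_primeFactorsList_natAbs (by norm_num) (by simp [Nat.primeFactorsList_ofNat])) (by norm_num)
    (by rw [KernelDisc.eval_Ψ₂Sq]; norm_num [b₂, b₄, b₆]) (by decide) (by decide) (by decide)

/-- `396864g2` = `[0,0,0,269556,1008364016]` (class `396864g`, (G-ord, `e = 2`) at `3`; twist `44096d2`, `a₃(V) = -1`, non-anomalous; even line
`φ = χ_{2}`): `x₀ = 6`, `D = 2`, `s = 44944`, `Ψ₂Sq(x₀) = 4039926272` ⇒ `X3LineDatumThree W`. [folklore] -/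
theorem x3LineDatumThree_396864g2 : X3LineDatumThree (⟨0, 0, 0, 269556, 1008364016⟩ : WeierstrassCurve ℚ) :=
  x3LineDatumThree_of_cert_of_delta _ (by norm_num [Δ, b₂, b₄, b₆, b₈]) 6 44944 2
    (by simp only [Ψ₃, eval_add, eval_mul, eval_pow, eval_C, eval_X, eval_ofNat]; norm_num [b₂, b₄, b₆, b₈])
    Int.prime_two.squarefree (by norm_num)
    (by rw [KernelDisc.eval_Ψ₂Sq]; norm_num [b₂, b₄, b₆]) (by decide) (by decide) (by decide)

/-- `398475bp2` = `[0,0,1,-1720065000,27457778625781]` (class `398475bp`, (G-ord, `e = 2`) at `3`; twist `44275f2`, `a₃(V) = 2`, non-anomalous; even line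
`φ = χ_{5}`): `x₀ = 24000`, `D = 5`, `s = 13225`, `Ψ₂Sq(x₀) = 874503125` ⇒ `X3LineDatumThree W`. [folklore] -/
theorem x3LineDatumThree_398475bp2 : X3LineDatumThree (⟨0, 0, 1, -1720065000, 27457778625781⟩ : WeierstrassCurve ℚ) :=
  x3LineDatumThree_of_cert_of_delta _ (by norm_num [Δ, b₂, b₄, b₆, b₈]) 24000 13225 5
    (by simp only [Ψ₃, eval_add, eval_mul, eval_pow, eval_C, eval_X, eval_ofNat]; norm_num [b₂, b₄, b₆, b₈])
    (X2.CellACertN9.squarefree_of_nodup_primeFactorsList_natAbs (by norm_num) (by simp [Nat.primeFactorsList_ofNat])) (by norm_num)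
    (by rw [KernelDisc.eval_Ψ₂Sq]; norm_num [b₂, b₄, b₆]) (by decide) (by decide) (by decide)

/-- `400050a2` = `[1,-1,0,-3054042,2021891116]` (class `400050a`, (G-ord, `e = 2`) at `3`; twist `44450z2`, `a₃(V) = -1`, non-anomalous; even line
`φ = χ_{5}`): `x₀ = 1354`, `D = 5`, `s = 17150`, `Ψ₂Sq(x₀) = 1470612500` ⇒ `X3LineDatumThree W`. [folklore] -/
theorem x3LineDatumThree_400050a2 : X3LineDatumThree (⟨1, -1, 0, -3054042, 2021891116⟩ : WeierstrassCurve ℚ) :=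
  x3LineDatumThree_of_cert_of_delta _ (by norm_num [Δ, b₂, b₄, b₆, b₈]) 1354 17150 5
    (by simp only [Ψ₃, eval_add, eval_mul, eval_pow, eval_C, eval_X, eval_ofNat]; norm_num [b₂, b₄, b₆, b₈])
    (X2.CellACertN9.squarefree_of_nodup_primeFactorsList_natAbs (by norm_num) (by simp [Nat.primeFactorsList_ofNat])) (by norm_num)
    (by rw [KernelDisc.eval_Ψ₂Sq]; norm_num [b₂, b₄, b₆]) (by decide) (by decide) (by decide)

/-- `400050h2` = `[1,-1,0,128583,367138741]` (class `400050h`, (G-ord, `e = 2`) at `3`; twist `44450ba2`, `a₃(V) = 2`, non-anomalous; even line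
`φ = χ_{5}`): `x₀ = 4`, `D = 5`, `s = 17150`, `Ψ₂Sq(x₀) = 1470612500` ⇒ `X3LineDatumThree W`. [folklore] -/
theorem x3LineDatumThree_400050h2 : X3LineDatumThree (⟨1, -1, 0, 128583, 367138741⟩ : WeierstrassCurve ℚ) :=
  x3LineDatumThree_of_cert_of_delta _ (by norm_num [Δ, b₂, b₄, b₆, b₈]) 4 17150 5
    (by simp only [Ψ₃, eval_add, eval_mul, eval_pow, eval_C, eval_X, eval_ofNat]; norm_num [b₂, b₄, b₆, b₈])
    (X2.CellACertN9.squarefree_of_nodup_primeFactorsList_natAbs (by norm_num) (by simp [Nat.primeFactorsList_ofNat])) (by norm_num)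
    (by rw [KernelDisc.eval_Ψ₂Sq]; norm_num [b₂, b₄, b₆]) (by decide) (by decide) (by decide)

/-- `400554h2` = `[1,-1,0,-22086,3334036]` (class `400554h`, (G-ord, `e = 2`) at `3`; twist `44506r2`, `a₃(V) = -1`, non-anomalous; even line
`φ = χ_{17}`): `x₀ = 13`, `D = 17`, `s = 847`, `Ψ₂Sq(x₀) = 12195953` ⇒ `X3LineDatumThree W`. [folklore] -/
theorem x3LineDatumThree_400554h2 : X3LineDatumThree (⟨1, -1, 0, -22086, 3334036⟩ : WeierstrassCurve ℚ) :=
  x3LineDatumThree_of_cert_of_delta _ (by norm_num [Δ, b₂, b₄, b₆, b₈]) 13 847 17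
    (by simp only [Ψ₃, eval_add, eval_mul, eval_pow, eval_C, eval_X, eval_ofNat]; norm_num [b₂, b₄, b₆, b₈])
    (X2.CellACertN9.squarefree_of_nodup_primeFactorsList_natAbs (by norm_num) (by simp [Nat.primeFactorsList_ofNat])) (by norm_num)
    (by rw [KernelDisc.eval_Ψ₂Sq]; norm_num [b₂, b₄, b₆]) (by decide) (by decide) (by decide)

end Summit.BirchSwinnertonDyer.Rank1Residual.Additive.X3ThreeLineDatumRecords
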